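import Summits.BirchSwinnertonDyer.BirchSwinnertonDyer.Theorems.SylvesterTwoHeegnerIndexCoupledTelescopeDerivList
import Summits.BirchSwinnertonDyer.Rank1Residual.X11b.RingClassFieldConj
import Summits.BirchSwinnertonDyer.Rank1Residual.X11b.KolyvaginConjugationDihedral
import Literature.NumberTheory.EllipticCurves.HuShuYin2019.SylvesterCMTowerReflection
import Literature.NumberTheory.EllipticCurves.RingClassFieldConjugation
import Literature.NumberTheory.EllipticCurves.GrossPointsKolyvaginDerivative
import HarnessLib

/-!
# The COUPLED Cassels–Tate telescope, XLVIII: REFLECTION THROUGH THE DERIVATIVE at the finite level `K[9pn]`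
# (Gross 1991 Prop. 5.4 (1), first half, on HSY's CM tower; crux `UpperOffV0HSYPlus`, stmt-BirchSwinnertonDyer-19804;
# plan (B) SIGNS file B-III (R))

For an automorphism `τ` of the level field `L = K[9pn]` MOVING `K` (a reflection: `τ σ τ⁻¹ = σ⁻¹` on
`𝒢 = Gal(L/K)`, tree `mul_mul_inv_eq_inv_of_not_mem_ringClassGal`) and Kolyvagin's derivative `D_{σ,q} = Σ_{i≤q} i σ^i`
with `σ^{q+1} = 1`:  `τ D_{σ,q} + D_{σ,q} τ = (q+1)·(Σ_{1≤j≤q} σ^j) τ` (Gross, proof of Prop. 5.4: `τ D_ℓ = D_ℓ^ι τ`,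
`D_ℓ^ι ≡ −D_ℓ (mod ℓ+1)`).  At the level `4^κ` of RESIDUE c v3 every Kolyvagin prime has `4^κ ∣ q + 1`, so along the
list `l` of the class system `τ (D_l y) = (−1)^{|l|} D_l (τ y) + 4^κ Z` — NO Euler-system relation is needed for this
half.  Then B-II (`HuShuYin2019.exists_conj_sub_sign_smul_galois_isOfFinAddOrder_sylvesterTower`, Gross 5.3 on HSY's
tower for the complex conjugation) is moved to EVERY reflection `τ ∉ 𝒢` (`τ = τ_c g`, dihedral law), and combined:
* `pointGalHom_derivOp_add_derivOp_of_conj` — `τ (D z) + D (τ z) = (q+1) • Σ_{j<q} σ^{j+1} (τ z)`;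
* `exists_pointGalHom_foldr_derivOp_of_conj` — `τ (D_l y) = (−1)^{|l|} • D_l (τ y) + m • Z` when `m ∣ q+1` on `l`;
* `foldr_derivOp_add/_zsmul`, `isOfFinAddOrder_foldr_derivOp` — `D_l` is additive and preserves torsion;
* `exists_galois_sign_isOfFinAddOrder_of_not_mem_ringClassGal` — B-II for every reflection of `K[9pn]`;
* ★ `exists_reflection_foldr_derivOp_sylvesterTower` — for HSY's CM point `y_n` and a list `l ⊆ 𝒢 × ℕ` with
  `σ^{q+1} = 1`, `m ∣ q+1`: `τ (D_l y_n) = ((−1)^{|l|} e) • σ (D_l y_n) + T₀ + m • Z`, `σ ∈ 𝒢`, `e = ±1` the Fricke sign,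
  `T₀` torsion — the finite-level input of Gross's Prop. 5.4 (1) in the CM frame (file B-III (F) transports it to
  `E₉(K̄)` and through the twisted trace).
Theorems only (no definition / named fact / instance / notation); nothing asserted on 19804; no stub closed;
X12.CMAtTwo NOT proved; BSD not claimed for any curve.  Sources: [GrossLMS1991] §3 (3.5), §5 Prop. 5.3, Prop. 5.4 (1)
(proof); [McCallumLMS1991] §4; [HuShuYin2019] §4.1; [Cox2013] Lemma 9.3.
`lean search 'derivOp_of_conj|reflection_foldr'` → nothing before this file.
-/

set_option linter.dupNamespace false -- Summits modules are `Summit.<Summit>.<Problem>…` by design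
set_option autoImplicit false

noncomputable section

open scoped Classical ComplexConjugate

namespace Summit.BirchSwinnertonDyer.BirchSwinnertonDyer.Theorems.SylvesterTwoCMFlip

open WeierstrassCurve Finset NumberField
open Literature.NumberTheory.EllipticCurves Literature.NumberTheory.EllipticCurves.ModularForms
  Literature.NumberTheory.EllipticCurves.HuShuYin2019
  Summit.BirchSwinnertonDyer.Rank1Residual.X11b

/-! ## §1 One reflection through one derivative, then through a list -/

section Generic

variable (W : WeierstrassCurve ℚ) {L : Type} [Field L] [CharZero L] [DecidableEq L]

omit [DecidableEq L] in
/-- `τ σ^i = σ^{q+1−i} τ` (`i ≤ q+1`) for `τ σ = σ⁻¹ τ`, `σ^{q+1} = 1`. [cite: GrossLMS1991, §5 (proof of Prop. 5.4)] -/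
theorem mul_pow_eq_pow_sub_mul_of_conj {τ σ : L ≃ₐ[ℚ] L} (hτσ : τ * σ = σ⁻¹ * τ) {q : ℕ}
    (hσ : σ ^ (q + 1) = 1) {i : ℕ} (hi : i ≤ q + 1) : τ * σ ^ i = σ ^ (q + 1 - i) * τ := by
  have hconj : τ * σ * τ⁻¹ = σ⁻¹ := by rw [hτσ, mul_inv_cancel_right]
  have hci : τ * σ ^ i * τ⁻¹ = (σ ^ i)⁻¹ := by
    have h := map_pow (MulAut.conj τ) σ i
    simp only [MulAut.conj_apply] at h
    rw [h, hconj, inv_pow]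
  have hinv : (σ ^ i)⁻¹ = σ ^ (q + 1 - i) :=
    inv_eq_of_mul_eq_one_right (by rw [← pow_add, Nat.add_sub_cancel' hi, hσ])
  rw [← hinv, ← hci, inv_mul_cancel_right]

/-- **`τ D_{σ,q} z + D_{σ,q} (τ z) = (q+1) • Σ_{j<q} σ^{j+1} (τ z)`** for a reflection `τ` (`τ σ = σ⁻¹ τ`) and `σ^{q+1} = 1`:
`τ D_ℓ = D_ℓ^ι τ` with `D_ℓ^ι = Σ i σ^{−i} = (ℓ+1)·Σ_{j≥1} σ^j − D_ℓ`. [cite: GrossLMS1991, §5 (proof of Prop. 5.4)]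
[cite: McCallumLMS1991, §4] -/
theorem pointGalHom_derivOp_add_derivOp_of_conj {τ σ : L ≃ₐ[ℚ] L} (hτσ : τ * σ = σ⁻¹ * τ) {q : ℕ}
    (hσ : σ ^ (q + 1) = 1) (z : (W.baseChange L).toAffine.Point) :
    pointGalHom W L τ (KolyvaginOperator.derivOp (pointGalHom W L) σ q z) +
        KolyvaginOperator.derivOp (pointGalHom W L) σ q (pointGalHom W L τ z) =
      (q + 1) • ∑ i ∈ Finset.range q, pointGalHom W L (σ ^ (i + 1)) (pointGalHom W L τ z) := by
  have hcomp : ∀ (a b : L ≃ₐ[ℚ] L) (x : (W.baseChange L).toAffine.Point),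
      pointGalHom W L a (pointGalHom W L b x) = pointGalHom W L (a * b) x := fun a b x ↦ by
    rw [map_mul]; rfl
  set w := pointGalHom W L τ z with hw
  -- `τ (D z) = Σ_{i ≤ q} i • σ^{q+1-i} w`
  have e1 : pointGalHom W L τ (KolyvaginOperator.derivOp (pointGalHom W L) σ q z) =
      ∑ i ∈ Finset.range (q + 1), i • pointGalHom W L (σ ^ (q + 1 - i)) w := by
    unfold KolyvaginOperator.derivOp
    rw [map_sum]
    refine Finset.sum_congr rfl fun i hi ↦ ?_
    rw [map_nsmul, hcomp, mul_pow_eq_pow_sub_mul_of_conj hτσ hσ (Finset.mem_range.mp hi).le,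
      ← hcomp]
  -- reflect the summation index
  have e2 : ∑ i ∈ Finset.range (q + 1), i • pointGalHom W L (σ ^ (q + 1 - i)) w =
      ∑ i ∈ Finset.range (q + 1), (q - i) • pointGalHom W L (σ ^ (i + 1)) w := by
    have h := Finset.sum_range_reflect (fun i ↦ i • pointGalHom W L (σ ^ (q + 1 - i)) w) (q + 1)
    rw [← h]
    refine Finset.sum_congr rfl fun i hi ↦ ?_
    have hi' := Finset.mem_range.mp hi
    rw [show q + 1 - 1 - i = q - i by omega, show q + 1 - (q - i) = i + 1 by omega]
  have e2' : ∑ i ∈ Finset.range (q + 1), (q - i) • pointGalHom W L (σ ^ (i + 1)) w =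
      ∑ i ∈ Finset.range q, (q - i) • pointGalHom W L (σ ^ (i + 1)) w := by
    rw [Finset.sum_range_succ, Nat.sub_self, zero_smul, add_zero]
  have e3 : KolyvaginOperator.derivOp (pointGalHom W L) σ q w =
      ∑ i ∈ Finset.range q, (i + 1) • pointGalHom W L (σ ^ (i + 1)) w := by
    unfold KolyvaginOperator.derivOp
    rw [Finset.sum_range_succ']
    simp only [zero_smul, add_zero]
  rw [e1, e2, e2', e3, ← Finset.sum_add_distrib, Finset.smul_sum]
  refine Finset.sum_congr rfl fun i hi ↦ ?_
  have hi' := Finset.mem_range.mp hi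
  rw [← add_smul, show q - i + (i + 1) = q + 1 by omega]

/-- **`τ (D_{σ,q} z) = −D_{σ,q} (τ z) + m • Z`** for a reflection `τ`, `σ^{q+1} = 1` and `m ∣ q + 1`.
[cite: GrossLMS1991, §5 (proof of Prop. 5.4)] [cite: McCallumLMS1991, §4] -/
theorem exists_pointGalHom_derivOp_of_conj {τ σ : L ≃ₐ[ℚ] L} (hτσ : τ * σ = σ⁻¹ * τ) {q : ℕ}
    (hσ : σ ^ (q + 1) = 1) {m : ℤ} (hm : m ∣ ((q + 1 : ℕ) : ℤ)) (z : (W.baseChange L).toAffine.Point) :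
    ∃ Z : (W.baseChange L).toAffine.Point,
      pointGalHom W L τ (KolyvaginOperator.derivOp (pointGalHom W L) σ q z) =
        -KolyvaginOperator.derivOp (pointGalHom W L) σ q (pointGalHom W L τ z) + m • Z := by
  obtain ⟨c, hc⟩ := hm
  refine ⟨c • ∑ i ∈ Finset.range q, pointGalHom W L (σ ^ (i + 1)) (pointGalHom W L τ z), ?_⟩
  have h := pointGalHom_derivOp_add_derivOp_of_conj W hτσ hσ z
  rw [smul_smul, ← hc, natCast_zsmul, ← h]
  abel

/-- `D_l` is additive. [cite: GrossLMS1991, §3 (3.5)] -/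
theorem foldr_derivOp_add (l : List ((L ≃ₐ[ℚ] L) × ℕ)) (y z : (W.baseChange L).toAffine.Point) :
    l.foldr (fun a x ↦ KolyvaginOperator.derivOp (pointGalHom W L) a.1 a.2 x) (y + z) =
      l.foldr (fun a x ↦ KolyvaginOperator.derivOp (pointGalHom W L) a.1 a.2 x) y +
        l.foldr (fun a x ↦ KolyvaginOperator.derivOp (pointGalHom W L) a.1 a.2 x) z := by
  induction l with
  | nil => rfl
  | cons a l ih => rw [List.foldr_cons, List.foldr_cons, List.foldr_cons, ih, KolyvaginOperator.derivOp_add]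

/-- `D_l (m • y) = m • D_l y`. [cite: GrossLMS1991, §3 (3.5)] -/
theorem foldr_derivOp_zsmul (l : List ((L ≃ₐ[ℚ] L) × ℕ)) (m : ℤ) (y : (W.baseChange L).toAffine.Point) :
    l.foldr (fun a x ↦ KolyvaginOperator.derivOp (pointGalHom W L) a.1 a.2 x) (m • y) =
      m • l.foldr (fun a x ↦ KolyvaginOperator.derivOp (pointGalHom W L) a.1 a.2 x) y := by
  induction l with
  | nil => rfl
  | cons a l ih => rw [List.foldr_cons, List.foldr_cons, ih, KolyvaginOperator.derivOp_zsmul]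

/-- `D_l` preserves torsion. [folklore] -/
theorem isOfFinAddOrder_foldr_derivOp (l : List ((L ≃ₐ[ℚ] L) × ℕ)) {y : (W.baseChange L).toAffine.Point}
    (hy : IsOfFinAddOrder y) :
    IsOfFinAddOrder (l.foldr (fun a x ↦ KolyvaginOperator.derivOp (pointGalHom W L) a.1 a.2 x) y) := by
  induction l with
  | nil => exact hy
  | cons a l ih =>
    rw [List.foldr_cons, ← KolyvaginOperator.derivOpHom_apply]
    exact AddMonoidHom.isOfFinAddOrder _ ih

/-- **`τ (D_l y) = (−1)^{|l|} • D_l (τ y) + m • Z`** along a list `l` of `(σ, q)` with `τ σ = σ⁻¹ τ`, `σ^{q+1} = 1`,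
`m ∣ q+1`: the reflection passes through Kolyvagin's derivative up to the sign `(−1)^{f_n}` and a multiple of `m`
(no Euler-system relation needed). [cite: GrossLMS1991, §5 (proof of Prop. 5.4: τ D_n = D_n^ι τ ≡ (−1)^{f_n} D_n τ)]
[cite: McCallumLMS1991, §4] -/
theorem exists_pointGalHom_foldr_derivOp_of_conj {τ : L ≃ₐ[ℚ] L} (l : List ((L ≃ₐ[ℚ] L) × ℕ))
    (hτ : ∀ a ∈ l, τ * a.1 = a.1⁻¹ * τ) (hord : ∀ a ∈ l, a.1 ^ (a.2 + 1) = 1) {m : ℤ}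
    (hdvd : ∀ a ∈ l, m ∣ ((a.2 + 1 : ℕ) : ℤ)) (y : (W.baseChange L).toAffine.Point) :
    ∃ Z : (W.baseChange L).toAffine.Point,
      pointGalHom W L τ (l.foldr (fun a x ↦ KolyvaginOperator.derivOp (pointGalHom W L) a.1 a.2 x) y) =
        ((-1 : ℤ) ^ l.length) • l.foldr (fun a x ↦ KolyvaginOperator.derivOp (pointGalHom W L) a.1 a.2 x)
          (pointGalHom W L τ y) + m • Z := by
  induction l with
  | nil => exact ⟨0, by simp⟩
  | cons a l ih =>
    obtain ⟨Z₂, hZ₂⟩ := ih (fun b hb ↦ hτ b (List.mem_cons_of_mem a hb)) (fun b hb ↦ hord b (List.mem_cons_of_mem a hb))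
      (fun b hb ↦ hdvd b (List.mem_cons_of_mem a hb))
    obtain ⟨Z₁, hZ₁⟩ := exists_pointGalHom_derivOp_of_conj W (hτ a List.mem_cons_self) (hord a List.mem_cons_self)
      (hdvd a List.mem_cons_self) (l.foldr (fun a x ↦ KolyvaginOperator.derivOp (pointGalHom W L) a.1 a.2 x) y)
    refine ⟨Z₁ - KolyvaginOperator.derivOp (pointGalHom W L) a.1 a.2 Z₂, ?_⟩
    rw [List.foldr_cons, List.foldr_cons, hZ₁, hZ₂, KolyvaginOperator.derivOp_add, KolyvaginOperator.derivOp_zsmul,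
      KolyvaginOperator.derivOp_zsmul, List.length_cons, pow_succ, zsmul_sub]
    rw [mul_neg_one, neg_zsmul]
    abel

end Generic

/-! ## §2 Gross's Prop. 5.3 on HSY's tower for EVERY reflection, and the reflected derived point -/

variable {K : Type} [Field K] [NumberField K]

/-- **B-II for every reflection `τ ∉ 𝒢 = Gal(K[9pn]/K)`**: `τ y_n = e σ y_n + torsion` with `σ ∈ 𝒢` and `e = ±1`
the Fricke sign of `Dt.f` — from the complex conjugation `τ_c` (B-II ★) via `τ = τ_c g`, `g ∈ 𝒢`, and the
dihedral law `τ_c (g y) = g⁻¹ (τ_c y)`. [cite: GrossLMS1991, Prop. 5.3, §5 (proof of Prop. 5.4)] [cite: Cox2013, Lemma 9.3] -/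
theorem exists_galois_sign_isOfFinAddOrder_of_not_mem_ringClassGal (hK : IsImaginaryQuadratic K)
    (hdK : NumberField.discr K = -3) (ι : K →+* ℂ) {W : WeierstrassCurve ℚ} [W.IsElliptic]
    (Dt : ModularParametrizationData W 243) {p n : ℕ} (hp : p % 3 = 1) (hn : n ≠ 0) (hn3 : ¬ 3 ∣ n)
    (hnC : IsCoprime (n : ℤ) (4 * (p : ℤ) ^ 2 + 18 * p + 81))
    {y : (W.baseChange (ringClassField K ι (9 * p * n))).toAffine.Point}
    (hy : WeierstrassCurve.Affine.Point.map (W' := W) (ringClassField K ι (9 * p * n)).subtype.toRatAlgHom y =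
      Dt.φ (heegnerTau ((n : ℤ) ^ 2 * (81 * ((p : ℤ) ^ 2 + 4 * p + 16)),
        (n : ℤ) * (-(9 * (4 * (p : ℤ) ^ 2 + 17 * p + 72))), 4 * (p : ℤ) ^ 2 + 18 * p + 81)))
    {τ : ringClassField K ι (9 * p * n) ≃ₐ[ℚ] ringClassField K ι (9 * p * n)}
    (hτ : τ ∉ ringClassGal ι (9 * p * n)) :
    ∃ σ ∈ ringClassGal ι (9 * p * n), ∃ e : ℤ, (e = 1 ∨ e = -1) ∧ (e : ℂ) = frickeEigenvalue Dt.f ∧ IsOfFinAddOrder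
      (pointGalHom W (ringClassField K ι (9 * p * n)) τ y -
        e • pointGalHom W (ringClassField K ι (9 * p * n)) σ y) := by
  have hp0 : p ≠ 0 := by rintro rfl; norm_num at hp
  have hN0 : 9 * p * n ≠ 0 := mul_ne_zero (mul_ne_zero (by norm_num) hp0) hn
  obtain ⟨τc, hτc⟩ := RingClassConj.exists_conj_algEquiv hK ι hN0
  have hτc' : τc ∉ ringClassGal ι (9 * p * n) := RingClassConj.conj_not_mem_ringClassGal hτc hK
  obtain ⟨σ₀, hσ₀, e, he1, he, htor⟩ :=
    exists_conj_sub_sign_smul_galois_isOfFinAddOrder_sylvesterTower hK hdK ι Dt hp hn hn3 hnC hy hτc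
  have hg : τc⁻¹ * τ ∈ ringClassGal ι (9 * p * n) := inv_mul_mem_ringClassGal_of_not_mem hK ι _ hτc' hτ
  have hcomp : ∀ (a b : ringClassField K ι (9 * p * n) ≃ₐ[ℚ] ringClassField K ι (9 * p * n))
      (x : (W.baseChange (ringClassField K ι (9 * p * n))).toAffine.Point),
      pointGalHom W _ a (pointGalHom W _ b x) = pointGalHom W _ (a * b) x := fun a b x ↦ by
    rw [map_mul]; rfl
  refine ⟨(τc⁻¹ * τ)⁻¹ * σ₀, mul_mem (inv_mem hg) hσ₀, e, he1, he, ?_⟩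
  have key : pointGalHom W _ τ y - e • pointGalHom W _ ((τc⁻¹ * τ)⁻¹ * σ₀) y =
      pointGalHom W _ (τc⁻¹ * τ)⁻¹ (pointGalHom W _ τc y - e • pointGalHom W _ σ₀ y) := by
    rw [map_sub, map_zsmul, hcomp _ σ₀,
      ← KolyvaginConj.pointGalHom_pointGalHom_of_not_mem_ringClassGal hK hN0 W hτc' hg, hcomp τc,
      mul_inv_cancel_left]
  rw [key]
  exact AddMonoidHom.isOfFinAddOrder _ htor

set_option maxHeartbeats 800000 in
/-- ★ **THE REFLECTED DERIVED POINT on HSY's tower** (Gross's Prop. 5.4 (1), finite-level half, in the exact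
currency of the class system): for the CM point `y_n` of conductor `9pn`, a list `l` of `(σ_q, q)` with `σ_q ∈ 𝒢`,
`σ_q^{q+1} = 1`, `m ∣ q + 1`, and ANY reflection `τ ∉ 𝒢`:
`τ (D_l y_n) = ((−1)^{|l|} e) • σ (D_l y_n) + T₀ + m • Z` with `σ ∈ 𝒢`, `e = ±1` the Fricke sign, `T₀` torsion.
[cite: GrossLMS1991, Prop. 5.3, Prop. 5.4 (1)] [cite: McCallumLMS1991, §4] [cite: HuShuYin2019, §4.1] -/
theorem exists_reflection_foldr_derivOp_sylvesterTower (hK : IsImaginaryQuadratic K)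
    (hdK : NumberField.discr K = -3) (ι : K →+* ℂ) {W : WeierstrassCurve ℚ} [W.IsElliptic]
    (Dt : ModularParametrizationData W 243) {p n : ℕ} (hp : p % 3 = 1) (hn : n ≠ 0) (hn3 : ¬ 3 ∣ n)
    (hnC : IsCoprime (n : ℤ) (4 * (p : ℤ) ^ 2 + 18 * p + 81))
    {y : (W.baseChange (ringClassField K ι (9 * p * n))).toAffine.Point}
    (hy : WeierstrassCurve.Affine.Point.map (W' := W) (ringClassField K ι (9 * p * n)).subtype.toRatAlgHom y =
      Dt.φ (heegnerTau ((n : ℤ) ^ 2 * (81 * ((p : ℤ) ^ 2 + 4 * p + 16)),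
        (n : ℤ) * (-(9 * (4 * (p : ℤ) ^ 2 + 17 * p + 72))), 4 * (p : ℤ) ^ 2 + 18 * p + 81)))
    (l : List ((ringClassField K ι (9 * p * n) ≃ₐ[ℚ] ringClassField K ι (9 * p * n)) × ℕ))
    (hl : ∀ a ∈ l, a.1 ∈ ringClassGal ι (9 * p * n)) (hord : ∀ a ∈ l, a.1 ^ (a.2 + 1) = 1)
    {m : ℤ} (hdvd : ∀ a ∈ l, m ∣ ((a.2 + 1 : ℕ) : ℤ))
    {τ : ringClassField K ι (9 * p * n) ≃ₐ[ℚ] ringClassField K ι (9 * p * n)}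
    (hτ : τ ∉ ringClassGal ι (9 * p * n)) :
    ∃ σ ∈ ringClassGal ι (9 * p * n), ∃ e : ℤ, (e = 1 ∨ e = -1) ∧ (e : ℂ) = frickeEigenvalue Dt.f ∧
      ∃ T₀ : (W.baseChange (ringClassField K ι (9 * p * n))).toAffine.Point, IsOfFinAddOrder T₀ ∧
      ∃ Z : (W.baseChange (ringClassField K ι (9 * p * n))).toAffine.Point,
        pointGalHom W _ τ (l.foldr (fun a x ↦ KolyvaginOperator.derivOp (pointGalHom W _) a.1 a.2 x) y) =
          ((-1 : ℤ) ^ l.length * e) •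
              pointGalHom W _ σ (l.foldr (fun a x ↦ KolyvaginOperator.derivOp (pointGalHom W _) a.1 a.2 x) y) +
            T₀ + m • Z := by
  have hp0 : p ≠ 0 := by rintro rfl; norm_num at hp
  have hN0 : 9 * p * n ≠ 0 := mul_ne_zero (mul_ne_zero (by norm_num) hp0) hn
  -- the dihedral law for the list
  have hτσ : ∀ a ∈ l, τ * a.1 = a.1⁻¹ * τ := fun a ha ↦ by
    rw [← mul_inv_eq_iff_eq_mul]
    exact mul_mul_inv_eq_inv_of_not_mem_ringClassGal hK ι hN0 hτ (hl a ha)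
  obtain ⟨Z₁, hZ₁⟩ := exists_pointGalHom_foldr_derivOp_of_conj W l hτσ hord hdvd y
  obtain ⟨σ, hσ, e, he1, he, htor⟩ :=
    exists_galois_sign_isOfFinAddOrder_of_not_mem_ringClassGal hK hdK ι Dt hp hn hn3 hnC hy hτ
  -- `σ` commutes with the list (`𝒢` is abelian)
  have hcomm : ∀ a ∈ l, Commute σ a.1 := fun a ha ↦ commute_of_mem_ringClassGal hK hN0 hσ (hl a ha)
  set T := pointGalHom W _ τ y - e • pointGalHom W _ σ y with hT
  have hτy : pointGalHom W _ τ y = e • pointGalHom W _ σ y + T := by rw [hT]; abel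
  refine ⟨σ, hσ, e, he1, he,
    ((-1 : ℤ) ^ l.length) • l.foldr (fun a x ↦ KolyvaginOperator.derivOp (pointGalHom W _) a.1 a.2 x) T,
    (isOfFinAddOrder_foldr_derivOp W l htor).zsmul, Z₁, ?_⟩
  rw [hZ₁, hτy, foldr_derivOp_add, foldr_derivOp_zsmul, ← pointGalHom_foldr_derivOp_comm W l hcomm, zsmul_add,
    ← mul_zsmul]

end Summit.BirchSwinnertonDyer.BirchSwinnertonDyer.Theorems.SylvesterTwoCMFlip

end
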